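import Literature.Analysis.FluidPDE.NSKatoToClayProofs
import Literature.Analysis.FluidPDE.NSFourierTaoClass
import Literature.Analysis.FluidPDE.NSFourierSplittingControl
import Literature.Analysis.FluidPDE.EnstrophySplittingDissipation
import Literature.Analysis.FluidPDE.TaoClassGlobal
import HarnessLib

/-!
# `clay_solution_of_hasGlobalKatoSolution` holds

Analysis/FluidPDE proof file: the **unconditional discharge** of the named fact
`Literature.Analysis.FluidPDE.clay_solution_of_hasGlobalKatoSolution` (`NSKatoToClay.lean`): for
`ν > 0` and a smooth, divergence-free, rapidly decaying datum `u₀` on `ℝ³` admitting a global Kato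
solution `w ∈ C([0, ∞); L³)`, there are jointly smooth `u`, `p` on `ℝ³ × [0, ∞)` solving the
Navier–Stokes system with datum `u₀` and with bounded energy (von Wahl: `C([0, T]; L³)` is a
regularity class; Lemarié-Rieusset 2016, Prop. 12.3, 4th item, with Thm. 7.2 and Thm. 7.7;
Kato 1984, Thm. 4 in the form of the fact's docstring).

`NSKatoToClayProofs` reduced the fact to Tao's local existence theorem for smooth `H^∞` data
(`tao2011_smooth_local_existence`, a named fact). Here that input is replaced by the tree's
**proved** local existence theorem in the Fourier class — the Fourier-side Picard construction of
Leray's regular solution, restartable from the Fourier-side state (`NSFourierRestart.FourierDatum`),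
which is a Tao-class solution on its slab (`FourierDatum.isTaoSolutionOn`, `NSFourierTaoClass`) —
together with an a-priori control of its lifespan along the solution that uses **no `L^∞` bound**:

1. (*von Wahl, `L²`-level*) as in `NSKatoToClayProofs`: any Tao-class solution from `u₀` on
   `[0, F]` is the Kato solution (`kato_unique_holds`), hence splits as `L³`-small plus bounded
   uniformly on `[0, T + 1]` (`ContinuousInLpOn.exists_forall_eLpNorm_indicator_le`), so that the
   enstrophy inequality under splitting bounds **both** `sup_t ∫|∇u|²` and the dissipation
   `ν ∫₀^F ∫ ‖Δu‖²` in terms of `u₀` only (`lintegral_laplacian_sq_le_of_split`,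
   `EnstrophySplittingDissipation`);
2. (*Plancherel*) along the construction the velocity is the synthesis `u(t) = synthVel V(t)` of a
   Fourier-side mild solution `V` on `[0, F]` (Fourier pieces glued by `IsFourierMild.glue`), whose
   energy and `L²_t Ḣ²` dissipation are therefore bounded by the physical ones
   (`IsFourierMild.dissip_le_of_synthVel`, `lintegral_enorm_sq_le_of_synthVel`,
   `NSFourierSplittingControl`);
3. (*Leray's doubling argument, `L^∞`-free*) hence the order-`4` Fourier weights of `V(t)` are at
   most `2^{⌈(T+1)/τ⌉} A₀` with a window `τ` depending only on `(ν, u₀, T)`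
   (`exists_window_of_energy_dissip`), and Picard's time of the restart from `V(t')` is bounded
   below uniformly; restarting `T_P/4` before the end and gluing (physically by
   `IsTaoSolutionOn.glue`, on the Fourier side by `IsFourierMild.glue`) covers `[0, T]` after
   finitely many steps (`exists_isTaoSolutionOn_of_hasGlobalKatoSolution'`);
4. (*patching*) Tao-class solutions on `[0, n + 1]` for all `n` give the global Clay-class solution
   (`IsTaoSolutionOn.global_of_nat`, `TaoClassGlobal`; bridge `isNavierStokesSolution_and_smooth_iff`).

Every ingredient is a theorem of the tree: no named fact is used
(`#print axioms clay_solution_of_hasGlobalKatoSolution_holds`: `propext`, `Classical.choice`,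
`Quot.sound`).

## References

* W. von Wahl, *The Equations of Navier–Stokes and Abstract Parabolic Equations*, Vieweg 1985
  (as cited in Lemarié-Rieusset 2016, Prop. 12.3 [494]).
* P. G. Lemarié-Rieusset, *The Navier–Stokes Problem in the 21st Century*, CRC Press 2016,
  Thm. 7.2 and its proof (PDF p. 147), Thm. 7.7 (p. 169), Thm. 11.2, Prop. 12.3 (p. 393).
* J. Leray, Acta Math. 63 (1934), §§19–21 (regular solution, restart). [Leray1934]
* T. Kato, Math. Z. 187 (1984), Thm. 4. [Kato1984]
-/

noncomputable section

open MeasureTheory Set Function Filter Topology Real Complex FourierTransform InnerProductSpace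
open scoped ENNReal NNReal ContDiff FourierTransform ComplexConjugate Laplacian

namespace Literature.Analysis.FluidPDE

open FourierNS

/-! ### The splitting data of a Tao-class solution along the Kato solution -/

/-- **The `L²_t H²_x` dissipation of a Tao-class solution along a Kato solution with small `L³`
tails** (the dissipation twin of `IsTaoSolutionOn.enstrophy_le_of_tails`): if the Tao-class
solution `(u, p)` on `[0, T]` agrees a.e. at every time with a field `w` whose `L³` tails above
height `λ` are at most `δ` on `[0, T]`, where `8 (δK)² ≤ ν²`, then with `M = max λ 1`
`∫₀ᵀ ∫ ‖Δu‖ₑ² ≤ ofReal (ν⁻¹ (1 + (4M²T/ν) e^{2M²T/ν})) ∫ ofReal |∇u₀|²`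
(`lintegral_laplacian_sq_le_of_split` with the truncation `b(t) = u(t) 1_{|u(t)| < λ}`). [cite: LemarieRieusset2016, Thm. 11.2 (11.9)–(11.10) with Prop. 12.3] -/
theorem IsTaoSolutionOn.lintegral_laplacian_sq_le_of_tails {T ν : ℝ}
    {u₀ : EuclideanSpace ℝ (Fin 3) → EuclideanSpace ℝ (Fin 3)}
    {u : ℝ → EuclideanSpace ℝ (Fin 3) → EuclideanSpace ℝ (Fin 3)}
    {p : ℝ → EuclideanSpace ℝ (Fin 3) → ℝ} (h : IsTaoSolutionOn T ν u₀ u p) (hν : 0 < ν)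
    (hT : 0 < T) {w : ℝ → EuclideanSpace ℝ (Fin 3) → EuclideanSpace ℝ (Fin 3)}
    (hae : ∀ t ∈ Icc 0 T, u t =ᵐ[volume] w t) {lam : ℝ≥0} {δ : ℝ} (hδ0 : 0 ≤ δ)
    (hδ : 8 * (δ * (SNormLESNormFDerivOfEqConst (EuclideanSpace ℝ (Fin 3))
        (volume : Measure (EuclideanSpace ℝ (Fin 3))) 2 : ℝ)) ^ 2 ≤ ν ^ 2)
    (htail : ∀ t ∈ Icc 0 T,
      eLpNorm ({x | lam ≤ ‖w t x‖₊}.indicator (w t)) 3 volume ≤ ENNReal.ofReal δ) :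
    ∫⁻ t in Ioo 0 T, ∫⁻ x, ‖(Δ (u t)) x‖ₑ ^ 2 ≤
      ENNReal.ofReal (ν⁻¹ * (1 + 4 * (max (lam : ℝ) 1) ^ 2 * T / ν *
        Real.exp (2 * (max (lam : ℝ) 1) ^ 2 * T / ν))) *
        ∫⁻ x, ENNReal.ofReal (frobeniusNormSq (fderiv ℝ u₀ x)) := by
  set M : ℝ := max (lam : ℝ) 1 with hM
  have hMpos : 0 < M := lt_of_lt_of_le one_pos (le_max_right _ _)
  set b : ℝ → EuclideanSpace ℝ (Fin 3) → EuclideanSpace ℝ (Fin 3) := fun t =>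
    u t - {x | lam ≤ ‖u t x‖₊}.indicator (u t) with hb
  have hcont : ∀ t ∈ Icc 0 T, Continuous (u t) := fun t ht =>
    (h.classical.contDiff_velocity ht).continuous
  have hset : ∀ t ∈ Icc 0 T, MeasurableSet {x | lam ≤ ‖u t x‖₊} := fun t ht =>
    measurableSet_le measurable_const (hcont t ht).nnnorm.measurable
  have hbm : ∀ t ∈ Icc 0 T, AEStronglyMeasurable (b t) volume := fun t ht =>
    ((hcont t ht).measurable.sub (((hcont t ht).measurable).indicator (hset t ht))).aestronglyMeasurable
  have hbM : ∀ t ∈ Icc 0 T, ∀ x, ‖b t x‖ ≤ M := by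
    intro t ht x
    simp only [hb, Pi.sub_apply, indicator, mem_setOf_eq]
    split_ifs with hx
    · simp only [sub_self, norm_zero]; exact hMpos.le
    · rw [sub_zero]
      have : ‖u t x‖ < lam := by
        have h' := not_le.1 hx
        exact_mod_cast h'
      exact this.le.trans (le_max_left _ _)
  have hsub : ∀ t, (fun x => u t x - b t x) = {x | lam ≤ ‖u t x‖₊}.indicator (u t) := by
    intro t
    funext x
    simp only [hb, Pi.sub_apply, sub_sub_cancel]
  have hsmall : ∀ t ∈ Icc 0 T, eLpNorm (fun x => u t x - b t x) 3 volume ≤ ENNReal.ofReal δ := by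
    intro t ht
    rw [hsub t]
    have hcongr : {x | lam ≤ ‖u t x‖₊}.indicator (u t) =ᵐ[volume]
        {x | lam ≤ ‖w t x‖₊}.indicator (w t) :=
      (hae t ht).mono fun x hx => by simp only [Set.indicator_apply, mem_setOf_eq, hx]
    rw [eLpNorm_congr_ae hcongr]
    exact htail t ht
  have hmain := lintegral_laplacian_sq_le_of_split hν hT h.classical h.sobolev h.sobolev_dt
    h.sobolev_p hMpos ⟨hT, le_rfl⟩ b hbm hbM hδ0 hsmall hδ
  rwa [h.initial] at hmain

/-! ### The Fourier–Picard solution from Fourier-class data: the restart piece -/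

/-- **The restart piece.** Given a Fourier-side coefficient field `a₁` on `ℝ³` with the properties
of a `FourierDatum` (continuity, every polynomial decay, an order-`4` weight `A`, the
divergence-free symbol relation, conjugation symmetry), the Fourier–Picard construction yields, on
the slab `[0, T_P]` with `T_P = picardTime (4π²ν) 4 (2A)`, a Tao-class solution `(u, p)` from the
datum `synthVel a₁` together with its Fourier side `V`, mild on `[0, T_P]`, with `u t = synthVel (V t)`
and `V 0 = a₁` (`FourierDatum.isTaoSolutionOn`, `PicardHyp.isFourierMild_limit`). [folklore] -/
theorem exists_isTaoSolutionOn_fourierPiece {ν : ℝ} (hν : 0 < ν)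
    {a₁ : EuclideanSpace ℝ (Fin 3) → Fin 3 → ℂ} (hcont : Continuous a₁)
    (hdecAll : ∀ K : ℕ, ∃ B, HasDecay K B a₁) {A : ℝ}
    (hA : HasDecay (Fintype.card (Fin 3) + 1) A a₁)
    (hdiv : ∀ ξ, ∑ l, (ξ l : ℂ) * a₁ ξ l = 0) (hconj : ∀ ξ l, a₁ (-ξ) l = conj (a₁ ξ l)) :
    ∃ (u : ℝ → EuclideanSpace ℝ (Fin 3) → EuclideanSpace ℝ (Fin 3))
      (p : ℝ → EuclideanSpace ℝ (Fin 3) → ℝ) (V : ℝ → EuclideanSpace ℝ (Fin 3) → Fin 3 → ℂ),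
      IsTaoSolutionOn (picardTime (Fin 3) (4 * π ^ 2 * ν) (Fintype.card (Fin 3) + 1) (2 * A)) ν
        (synthVel a₁) u p ∧
      IsFourierMild (4 * π ^ 2 * ν) (Fintype.card (Fin 3) + 1) 0
        (picardTime (Fin 3) (4 * π ^ 2 * ν) (Fintype.card (Fin 3) + 1) (2 * A)) V ∧
      (∀ t, u t = synthVel (V t)) ∧ V 0 = a₁ := by
  set d : FourierDatum (Fin 3) :=
    { ν := ν, hν := hν, a := a₁, cont := hcont, decayAll := hdecAll, A := A, decayA := hA,
      divFree := hdiv, conjSymm := hconj } with hd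
  have hmild : IsFourierMild d.c d.K₀ 0 d.T d.v :=
    d.hyp.isFourierMild_limit rfl d.decayAll d.divFree d.conjSymm
  have hv0 : d.v 0 = a₁ := funext fun ξ => d.v_zero ξ
  have hu0 : d.u 0 = synthVel a₁ := by rw [d.u_eq_synthVel, hv0]
  refine ⟨d.u, d.p, d.v, ?_, hmild, fun t => d.u_eq_synthVel t, hv0⟩
  have h := d.isTaoSolutionOn
  rwa [hu0] at h

/-! ### Tao-class solutions of every length from a global Kato solution, unconditionally -/

/-- **`C([0, T]; L³)` is a regularity class — constructive, unconditional form.** For `ν > 0`, a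
smooth, divergence-free, rapidly decaying datum `u₀` with a global Kato solution, and every
`T > 0`, there is a Tao-class solution from `u₀` on the closed slab `[0, T] × ℝ³`. The proof is
the restart induction of `exists_isTaoSolutionOn_of_hasGlobalKatoSolution` (`NSKatoToClayProofs`)
with Tao's local existence theorem replaced by the Fourier–Picard restart piece
(`exists_isTaoSolutionOn_fourierPiece`), whose lifespan `T_P` is uniform along the induction
because the order-`4` Fourier weights of the restart data `V(t')` are controlled, without any
`L^∞` bound, by the energy and the `L²_t H²_x` dissipation of the solution
(`FourierNS.exists_window_of_energy_dissip`), which are bounded in terms of `u₀` by the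
enstrophy inequality under the `L³`-small plus bounded splitting valid along the Kato solution
(`IsTaoSolutionOn.lintegral_laplacian_sq_le_of_tails`) and Plancherel
(`IsFourierMild.dissip_le_of_synthVel`). The state of the induction carries the physical
Tao-class solution (glued by `IsTaoSolutionOn.glue`) and its Fourier side (glued by
`IsFourierMild.glue`), synthesising to it at every time. [cite: LemarieRieusset2016, Prop. 12.3 (von Wahl) with Thm. 7.2, PDF pp. 147, 393] -/
theorem exists_isTaoSolutionOn_of_hasGlobalKatoSolution' {ν : ℝ} (hν : 0 < ν)
    {u₀ : EuclideanSpace ℝ (Fin 3) → EuclideanSpace ℝ (Fin 3)} (hsm : ContDiff ℝ ∞ u₀)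
    (hdiv : NSWave0.IsDivFree u₀) (hdec : HasRapidSpatialDecay u₀)
    (hK : HasGlobalKatoSolution ν u₀) {Tt : ℝ} (hTt : 0 < Tt) :
    ∃ (u : ℝ → EuclideanSpace ℝ (Fin 3) → EuclideanSpace ℝ (Fin 3))
      (p : ℝ → EuclideanSpace ℝ (Fin 3) → ℝ), IsTaoSolutionOn Tt ν u₀ u p := by
  obtain ⟨w, hwmild, hwc, hw0, hwm⟩ := hK.exists_restrict
  set Tw : ℝ := Tt + 1 with hTw
  have hTtw : Tt < Tw := by rw [hTw]; linarith
  have hTw0 : 0 < Tw := hTt.trans hTtw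
  /- the splitting threshold `8 (δK)² ≤ ν²` and the `L³` tails of `w` on `[0, Tw]` -/
  set Ks : ℝ := (SNormLESNormFDerivOfEqConst (EuclideanSpace ℝ (Fin 3))
    (volume : Measure (EuclideanSpace ℝ (Fin 3))) 2 : ℝ) with hKs
  have hKs0 : 0 ≤ Ks := NNReal.coe_nonneg _
  set δ : ℝ := ν / (4 * (Ks + 1)) with hδdef
  have hδ0 : 0 < δ := by positivity
  have hδK : δ * Ks ≤ ν / 4 := by
    rw [hδdef, div_mul_eq_mul_div, div_le_div_iff₀ (by positivity) (by positivity)]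
    nlinarith [hν]
  have hδ8 : 8 * (δ * Ks) ^ 2 ≤ ν ^ 2 := by nlinarith [hδK, mul_nonneg hδ0.le hKs0]
  have hδ2 : 2 * (δ * Ks) ^ 2 ≤ ν ^ 2 := by nlinarith [hδ8, sq_nonneg (δ * Ks)]
  obtain ⟨lam, hlam⟩ := (hwc (Icc 0 Tw) Icc_subset_Ici_self).exists_forall_eLpNorm_indicator_le
    isCompact_Icc (by norm_num : (1 : ℝ≥0∞) ≤ 3) (by norm_num) hδ0
  set M : ℝ := max (lam : ℝ) 1 with hM
  have hMpos : 0 < M := lt_of_lt_of_le one_pos (le_max_right _ _)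
  /- energy and enstrophy of the datum -/
  set e₀ : ℝ := 2 * VectorCalculus.kineticEnergy u₀ with he₀
  have he₀0 : 0 ≤ e₀ := mul_nonneg zero_le_two (kineticEnergy_nonneg _)
  have hHinf : ∀ n : ℕ, ∫⁻ x, ‖iteratedFDeriv ℝ n u₀ x‖ₑ ^ 2 < ⊤ :=
    hdec.lintegral_enorm_iteratedFDeriv_sq_lt_top
  have hG₀ : ∫⁻ x, ENNReal.ofReal (frobeniusNormSq (fderiv ℝ u₀ x)) < ⊤ := by
    calc ∫⁻ x, ENNReal.ofReal (frobeniusNormSq (fderiv ℝ u₀ x))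
        ≤ ∫⁻ x, 3 * ‖iteratedFDeriv ℝ 1 u₀ x‖ₑ ^ 2 := lintegral_mono fun x => by
          rw [← ofReal_norm, norm_iteratedFDeriv_one, ofReal_norm]
          exact ofReal_frobeniusNormSq_le_three_mul_enorm_sq _
      _ = 3 * ∫⁻ x, ‖iteratedFDeriv ℝ 1 u₀ x‖ₑ ^ 2 := lintegral_const_mul' _ _ (by simp)
      _ < ⊤ := ENNReal.mul_lt_top (by simp) (hHinf 1)
  set g₀ : ℝ := (∫⁻ x, ENNReal.ofReal (frobeniusNormSq (fderiv ℝ u₀ x))).toReal with hg₀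
  have hg₀0 : 0 ≤ g₀ := ENNReal.toReal_nonneg
  have hg₀eq : ∫⁻ x, ENNReal.ofReal (frobeniusNormSq (fderiv ℝ u₀ x)) = ENNReal.ofReal g₀ := by
    rw [hg₀, ENNReal.ofReal_toReal hG₀.ne]
  /- the dissipation budget -/
  set κw : ℝ := ν⁻¹ * (1 + 4 * M ^ 2 * Tw / ν * Real.exp (2 * M ^ 2 * Tw / ν)) with hκw
  have hκw0 : 0 ≤ κw := by positivity
  set D : ℝ := ((2 * π) ^ 4)⁻¹ * (κw * g₀) with hD
  have hD0 : 0 ≤ D := by positivity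
  /- the heat rate, the order, the window, the initial Fourier datum -/
  set cF : ℝ := 4 * π ^ 2 * ν with hcF
  have hcF0 : 0 < cF := by positivity
  have hι : Fintype.card (Fin 3) < 4 := by simp
  obtain ⟨τw, hτw, hwindow⟩ := exists_window_of_energy_dissip (ι := Fin 3) hι hcF0
    (Fintype.card (Fin 3) + 1) he₀0 hD0
  set a₀ : EuclideanSpace ℝ (Fin 3) → Fin 3 → ℂ := fourierData hsm hdec with ha₀
  obtain ⟨A₀, hA₀⟩ := hasDecay_fourierData hsm hdec (Fintype.card (Fin 3) + 1)
  have hA₀0 : 0 ≤ A₀ := hA₀.nonneg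
  set Aunif : ℝ := 2 ^ ⌈Tw / τw⌉₊ * A₀ with hAunif
  have hAunif0 : 0 ≤ Aunif := by positivity
  set TP : ℝ := picardTime (Fin 3) cF (Fintype.card (Fin 3) + 1) (2 * Aunif) with hTP
  have hTPpos : 0 < TP := picardTime_pos hcF0 _ _ (by positivity)
  have hdiv' : ∀ ξ : EuclideanSpace ℝ (Fin 3), ∑ l, (ξ l : ℂ) * a₀ ξ l = 0 :=
    sum_mul_fourierData hsm hdec hdiv
  have hconj₀ : ∀ ξ l, a₀ (-ξ) l = conj (a₀ ξ l) := fourierData_conj_symm hsm hdec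
  have hsynth₀ : synthVel a₀ = u₀ := by
    funext x
    ext l
    rw [synthVel_apply, show (fun ξ => a₀ ξ l) = fun ξ => fourierData hsm hdec ξ l from rfl,
      fourier_fourierData hsm hdec l]
    simp
  /- the state of the induction -/
  set State : ℝ → (ℝ → EuclideanSpace ℝ (Fin 3) → EuclideanSpace ℝ (Fin 3)) →
      (ℝ → EuclideanSpace ℝ (Fin 3) → ℝ) → (ℝ → EuclideanSpace ℝ (Fin 3) → Fin 3 → ℂ) → Prop :=
    fun F u p V => IsTaoSolutionOn F ν u₀ u p ∧
      IsFourierMild cF (Fintype.card (Fin 3) + 1) 0 F V ∧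
      (∀ t ∈ Icc 0 F, u t = synthVel (V t)) ∧ V 0 = a₀ with hState
  /- uniform bounds for a state on `[0, F]`, `F ≤ Tw`: energy, dissipation, weights -/
  have hbounds : ∀ ⦃F : ℝ⦄ ⦃u : ℝ → EuclideanSpace ℝ (Fin 3) → EuclideanSpace ℝ (Fin 3)⦄
      ⦃p : ℝ → EuclideanSpace ℝ (Fin 3) → ℝ⦄ ⦃V : ℝ → EuclideanSpace ℝ (Fin 3) → Fin 3 → ℂ⦄,
      0 < F → F ≤ Tw → State F u p V →
        ∀ t' ∈ Icc 0 F, HasDecay (Fintype.card (Fin 3) + 1) Aunif (V t') := by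
    intro F u p V hF hFw hS t' ht'
    obtain ⟨h, hV, hsyn, hV0⟩ := hS
    -- identification with the Kato solution and the `L³` tails
    have hae : ∀ s ∈ Icc 0 F, u s =ᵐ[volume] w s :=
      h.ae_eq_of_kato_Icc hν hF (hwmild F) (hwc (Icc 0 F) Icc_subset_Ici_self) (hwm F)
    have htail : ∀ s ∈ Icc 0 F,
        eLpNorm ({x | lam ≤ ‖w s x‖₊}.indicator (w s)) 3 volume ≤ ENNReal.ofReal δ :=
      fun s hs => hlam s ⟨hs.1, hs.2.trans hFw⟩
    -- energy of the Fourier side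
    have hE : ∀ r ∈ Icc 0 F, ∫⁻ η, ‖V r η‖ₑ ^ 2 ≤ ENNReal.ofReal e₀ := by
      intro r hr
      have hdecr : ∀ K : ℕ, ∃ B, HasDecay K B (V r) := fun K => by
        obtain ⟨B, hB⟩ := hV.decay K
        exact ⟨B, hB r⟩
      calc ∫⁻ η, ‖V r η‖ₑ ^ 2 ≤ ∫⁻ x, ‖synthVel (V r) x‖ₑ ^ 2 :=
            lintegral_enorm_sq_le_of_synthVel (V r) (hV.continuous_slice r) hdecr
              (fun ξ l => hV.conjSymm r ξ l)
        _ = ∫⁻ x, ‖u r x‖ₑ ^ 2 := by rw [hsyn r hr]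
        _ ≤ ENNReal.ofReal e₀ := h.lintegral_enorm_sq_le hF hν.le hr
    -- dissipation of the Fourier side
    have hDis : dissip V 0 F ≤ ENNReal.ofReal D := by
      have h1 : ∀ r ∈ Icc 0 F, ∫⁻ x, ‖iteratedFDeriv ℝ 1 (u r) x‖ₑ ^ 2 < ⊤ := fun r hr =>
        (h.slice hr).2.2 1
      have h2 : ∀ r ∈ Icc 0 F, ∫⁻ x, ‖iteratedFDeriv ℝ 2 (u r) x‖ₑ ^ 2 < ⊤ := fun r hr =>
        (h.slice hr).2.2 2
      have h3 : ∀ r ∈ Icc 0 F, ∫⁻ x, ‖iteratedFDeriv ℝ 3 (u r) x‖ₑ ^ 2 < ⊤ := fun r hr =>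
        (h.slice hr).2.2 3
      have hdis := hV.dissip_le_of_synthVel hsyn (fun r hr => (h.slice hr).1) h1 h2 h3 le_rfl le_rfl
      have hlap := h.lintegral_laplacian_sq_le_of_tails hν hF hae hδ0.le hδ8 htail
      have hIoc : ∫⁻ r in Ioc 0 F, ∫⁻ x, ‖(Δ (u r)) x‖ₑ ^ 2 =
          ∫⁻ r in Ioo 0 F, ∫⁻ x, ‖(Δ (u r)) x‖ₑ ^ 2 := setLIntegral_congr Ioo_ae_eq_Ioc.symm
      have hκle : ν⁻¹ * (1 + 4 * M ^ 2 * F / ν * Real.exp (2 * M ^ 2 * F / ν)) ≤ κw := by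
        rw [hκw]
        refine mul_le_mul_of_nonneg_left ?_ (by positivity)
        have hexp : Real.exp (2 * M ^ 2 * F / ν) ≤ Real.exp (2 * M ^ 2 * Tw / ν) :=
          Real.exp_le_exp.2 (div_le_div_of_nonneg_right
            (mul_le_mul_of_nonneg_left hFw (by positivity)) hν.le)
        have h4 : 4 * M ^ 2 * F / ν ≤ 4 * M ^ 2 * Tw / ν :=
          div_le_div_of_nonneg_right (mul_le_mul_of_nonneg_left hFw (by positivity)) hν.le
        have h5 : 0 ≤ 4 * M ^ 2 * F / ν := by positivity
        nlinarith [mul_le_mul h4 hexp (Real.exp_nonneg _) (h5.trans h4), Real.exp_nonneg (2 * M ^ 2 * F / ν)]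
      calc dissip V 0 F ≤ ENNReal.ofReal (((2 * π) ^ 4)⁻¹) *
            ∫⁻ r in Ioc 0 F, ∫⁻ x, ‖(Δ (u r)) x‖ₑ ^ 2 := hdis
        _ ≤ ENNReal.ofReal (((2 * π) ^ 4)⁻¹) * (ENNReal.ofReal κw * ENNReal.ofReal g₀) := by
            rw [hIoc, ← hg₀eq]
            gcongr
            exact hlap.trans (mul_le_mul_of_nonneg_right (ENNReal.ofReal_le_ofReal hκle) bot_le)
        _ = ENNReal.ofReal D := by
            rw [hD, ← ENNReal.ofReal_mul hκw0, ← ENNReal.ofReal_mul (by positivity)]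
    -- the doubling argument
    have hVA₀ : HasDecay (Fintype.card (Fin 3) + 1) A₀ (V 0) := by rw [hV0]; exact hA₀
    have hdecay := hwindow hV hE hDis hVA₀ t' ht'
    rw [sub_zero] at hdecay
    refine hdecay.mono (mul_le_mul_of_nonneg_right ?_ hA₀0)
    exact pow_le_pow_right₀ one_le_two (Nat.ceil_le_ceil (div_le_div_of_nonneg_right hFw hτw.le))
  /- the restart step -/
  have hstep : ∀ ⦃F : ℝ⦄ ⦃u : ℝ → EuclideanSpace ℝ (Fin 3) → EuclideanSpace ℝ (Fin 3)⦄
      ⦃p : ℝ → EuclideanSpace ℝ (Fin 3) → ℝ⦄ ⦃V : ℝ → EuclideanSpace ℝ (Fin 3) → Fin 3 → ℂ⦄,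
      0 < F → F ≤ Tt → State F u p V →
      ∃ (F' : ℝ) (u' : ℝ → EuclideanSpace ℝ (Fin 3) → EuclideanSpace ℝ (Fin 3))
        (p' : ℝ → EuclideanSpace ℝ (Fin 3) → ℝ) (V' : ℝ → EuclideanSpace ℝ (Fin 3) → Fin 3 → ℂ),
        (Tw ≤ F' ∨ F + TP / 2 ≤ F') ∧ F' ≤ Tw ∧ 0 < F' ∧ State F' u' p' V' := by
    intro F u p V hF hFT hS
    have hFw : F ≤ Tw := hFT.trans hTtw.le
    have hdecay := hbounds hF hFw hS
    obtain ⟨h, hV, hsyn, hV0⟩ := hS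
    set t' : ℝ := max (F / 2) (F - TP / 4) with ht'
    have ht'0 : 0 ≤ t' := le_max_of_le_left (by linarith)
    have ht'F : t' < F := max_lt (by linarith) (by linarith)
    have hFt' : F ≤ t' + TP := by linarith [le_max_right (F / 2) (F - TP / 4)]
    have ht'I : t' ∈ Icc 0 F := ⟨ht'0, ht'F.le⟩
    -- the restart piece from the Fourier-side state `V t'`
    have hdecAll : ∀ K : ℕ, ∃ B, HasDecay K B (V t') := fun K => by
      obtain ⟨B, hB⟩ := hV.decay K
      exact ⟨B, hB t'⟩
    obtain ⟨v, q, W, hv, hW, hvsyn, hW0⟩ := exists_isTaoSolutionOn_fourierPiece hν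
      (hV.continuous_slice t') hdecAll (hdecay t' ht'I) (hV.divFree t') (hV.conjSymm t')
    rw [← hcF, ← hTP] at hv hW
    have hvt' : synthVel (V t') = u t' := (hsyn t' ht'I).symm
    rw [hvt'] at hv
    -- the physical glue
    have hglue := h.glue hv hν hTPpos ht'0 ht'F hFt'
    -- the agreement on the overlap
    have hagree : ∀ s ∈ Ico 0 (min (F - t') TP), u (s + t') = v s :=
      (h.translate ht'0 ht'F).eq_of_isTaoSolutionOn hv hν (by linarith) hTPpos
    -- the Fourier glue
    have hW' : IsFourierMild cF (Fintype.card (Fin 3) + 1) t' (t' + TP) (fun t => W (t - t')) := by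
      have := hW.translate t'
      simpa only [zero_add, add_comm TP t'] using this
    have hVt' : IsFourierMild cF (Fintype.card (Fin 3) + 1) 0 t' V := hV.mono le_rfl ht'0 ht'F.le
    have hjunction : V t' = (fun t => W (t - t')) t' := by simp only [sub_self, hW0]
    have hGlueF := hVt'.glue hW' hjunction
    set F' : ℝ := min (t' + TP) Tw with hF'
    have hF'pos : 0 < F' := lt_min (by linarith) hTw0
    have hF'le : F' ≤ t' + TP := min_le_left _ _
    refine ⟨F', (fun t => if t < F then u t else v (t - t')),
      (fun t => if t < F then p t else q (t - t')), (fun t => if t ≤ t' then V t else W (t - t')),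
      ?_, min_le_right _ _, hF'pos, ?_, ?_, ?_, ?_⟩
    · by_cases hcase : t' + TP ≤ Tw
      · right; rw [hF', min_eq_left hcase]; linarith [le_max_right (F / 2) (F - TP / 4)]
      · left; rw [hF', min_eq_right (le_of_not_ge hcase)]
    · exact hglue.mono hF'pos hF'le
    · exact hGlueF.mono le_rfl hF'pos.le hF'le
    · -- synthesis at every time of `[0, F']`
      intro t ht
      by_cases htt' : t ≤ t'
      · have htF : t < F := lt_of_le_of_lt htt' ht'F
        simp only [if_pos htF, if_pos htt']
        exact hsyn t ⟨ht.1, htF.le⟩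
      · have hgt : t' < t := not_le.1 htt'
        simp only [if_neg htt']
        by_cases htF : t < F
        · simp only [if_pos htF]
          have hs : t - t' ∈ Ico 0 (min (F - t') TP) :=
            ⟨by linarith, lt_min (by linarith) (by linarith [ht.2])⟩
          have := hagree (t - t') hs
          rw [sub_add_cancel] at this
          rw [this, hvsyn]
        · simp only [if_neg htF]
          exact hvsyn (t - t')
    · -- the initial Fourier datum is unchanged
      show (if (0 : ℝ) ≤ t' then V 0 else W (0 - t')) = a₀
      rw [if_pos ht'0, hV0]
  /- the first state, from the Schwartz datum -/
  have hbase : ∃ (F : ℝ) (u : ℝ → EuclideanSpace ℝ (Fin 3) → EuclideanSpace ℝ (Fin 3))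
      (p : ℝ → EuclideanSpace ℝ (Fin 3) → ℝ) (V : ℝ → EuclideanSpace ℝ (Fin 3) → Fin 3 → ℂ),
      0 < F ∧ F ≤ Tw ∧ State F u p V := by
    obtain ⟨u, p, V, hu, hV, hsyn, hV0⟩ := exists_isTaoSolutionOn_fourierPiece hν
      (continuous_fourierData hsm hdec) (hasDecay_fourierData hsm hdec) hA₀ hdiv' hconj₀
    rw [hsynth₀] at hu
    set T₀ : ℝ := picardTime (Fin 3) (4 * π ^ 2 * ν) (Fintype.card (Fin 3) + 1) (2 * A₀) with hT₀
    have hT₀pos : 0 < T₀ := picardTime_pos hcF0 _ _ (by positivity)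
    set F₀ : ℝ := min T₀ 1 with hF₀
    have hF₀pos : 0 < F₀ := lt_min hT₀pos one_pos
    refine ⟨F₀, u, p, V, hF₀pos, (min_le_right _ _).trans (by rw [hTw]; linarith), ?_, ?_, ?_, hV0⟩
    · exact hu.mono hF₀pos (min_le_left _ _)
    · exact hV.mono le_rfl hF₀pos.le (min_le_left _ _)
    · exact fun t _ => hsyn t
  /- the induction -/
  have hiter : ∀ k : ℕ, ∃ (F : ℝ) (u : ℝ → EuclideanSpace ℝ (Fin 3) → EuclideanSpace ℝ (Fin 3))
      (p : ℝ → EuclideanSpace ℝ (Fin 3) → ℝ) (V : ℝ → EuclideanSpace ℝ (Fin 3) → Fin 3 → ℂ),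
      0 < F ∧ F ≤ Tw ∧ State F u p V ∧ (Tt ≤ F ∨ (k : ℝ) * (TP / 2) ≤ F) := by
    intro k
    induction k with
    | zero =>
      obtain ⟨F, u, p, V, hF, hFw, hS⟩ := hbase
      exact ⟨F, u, p, V, hF, hFw, hS, Or.inr (by simpa using hF.le)⟩
    | succ k ih =>
      obtain ⟨F, u, p, V, hF, hFw, hS, halt⟩ := ih
      rcases le_or_gt Tt F with hdone | hlt
      · exact ⟨F, u, p, V, hF, hFw, hS, Or.inl hdone⟩
      · obtain ⟨F', u', p', V', hprog, hF'w, hF'pos, hS'⟩ := hstep hF hlt.le hS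
        refine ⟨F', u', p', V', hF'pos, hF'w, hS', ?_⟩
        rcases hprog with hTw' | hadv
        · exact Or.inl (hTtw.le.trans hTw')
        · rcases halt with hd | hk
          · exact absurd hd (not_le.2 hlt)
          · right
            push_cast
            linarith
  obtain ⟨k, hk⟩ := exists_nat_gt (Tw / (TP / 2))
  obtain ⟨F, u, p, V, hF, hFw, hS, halt⟩ := hiter k
  have hTtF : Tt ≤ F := by
    rcases halt with hd | hk'
    · exact hd
    · exfalso
      have h2 : Tw < (k : ℝ) * (TP / 2) := by rwa [div_lt_iff₀ (by positivity)] at hk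
      linarith
  exact ⟨u, p, hS.1.mono hTt hTtF⟩

/-! ### The discharge -/

/-- **`clay_solution_of_hasGlobalKatoSolution` holds** (Kato 1984, Thm. 4, in the form of the
fact's docstring; von Wahl 1985 / Lemarié-Rieusset 2016, Prop. 12.3 with Thm. 7.2 and Thm. 7.7):
for `ν > 0` and `u₀` smooth, divergence free and rapidly decaying with a global Kato solution, there
are jointly smooth `u`, `p` on `ℝ³ × [0, ∞)` solving the Navier–Stokes system with datum `u₀` and
with bounded energy. Tao-class solutions of every integer length
(`exists_isTaoSolutionOn_of_hasGlobalKatoSolution'`) are patched by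
`IsTaoSolutionOn.global_of_nat` and converted by `isNavierStokesSolution_and_smooth_iff`.
Unconditional: every ingredient is proved in the tree. [cite: LemarieRieusset2016, Prop. 12.3 (von Wahl) with Thm. 7.2 and Thm. 7.7, PDF pp. 147, 169, 393] -/
theorem clay_solution_of_hasGlobalKatoSolution_holds : clay_solution_of_hasGlobalKatoSolution := by
  intro ν hν u₀ hsm hdiv hdec hK
  have hex : ∀ n : ℕ, ∃ (u : ℝ → EuclideanSpace ℝ (Fin 3) → EuclideanSpace ℝ (Fin 3))
      (p : ℝ → EuclideanSpace ℝ (Fin 3) → ℝ), IsTaoSolutionOn ((n : ℝ) + 1) ν u₀ u p := fun n =>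
    exists_isTaoSolutionOn_of_hasGlobalKatoSolution' hν hsm hdiv hdec hK (by positivity)
  choose U P hUP using hex
  obtain ⟨hcl, h0, hEn⟩ := IsTaoSolutionOn.global_of_nat hUP hν
  obtain ⟨hns, hsu, hsp⟩ := isNavierStokesSolution_and_smooth_iff.2 ⟨hcl, h0⟩
  exact ⟨_, _, hsu, hsp, hns, hEn⟩

end Literature.Analysis.FluidPDE

end
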